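import Literature.NumberTheory.EllipticCurves.RealLatticePeriodDiscrProofs
import Mathlib.Algebra.Module.ZLattice.Covolume
import Mathlib.MeasureTheory.Measure.Haar.InnerProductSpace
import HarnessLib

/-!
# The covolume of a real lattice: `2 · covol(Λ) = n · Ω₀ · Ω₀'`

Everything in this file is proved (no definitions, no named facts). For a **real lattice**
`Λ ⊂ ℂ` (a Mathlib `PeriodPair` `L` with `L.IsReal`, file `Uniformization`) write
`Ω₀ = L.minRealPeriod` for its least positive real period (`Λ ∩ ℝ = ℤΩ₀`,
`PeriodPair.IsReal.exists_eq_int_mul`) and `Ω₀'` for the least positive real period of the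
rotated real lattice `iΛ` (`PeriodPair.IsReal.mulLeft_I`), so that `Λ ∩ iℝ = ℤ iΩ₀'`. This file
proves the classical description of a real lattice by its *primitive real and imaginary periods*
(Lawden, *Elliptic Functions and Applications*, §6.15–§6.16; Du Val, *Elliptic Functions and
Elliptic Curves*, §11 "real lattices are rectangular or rhombic"):

* `PeriodPair.IsReal.exists_eq_lattice` — **classification with an explicit basis**:
  either `Λ = ℤΩ₀ ⊕ ℤ iΩ₀'` (*rectangular*) or `Λ = ℤΩ₀ ⊕ ℤ (Ω₀ + iΩ₀')/2` (*rhombic*), the second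
  case occurring exactly when `(Ω₀ + iΩ₀')/2 ∈ Λ`;
* `PeriodPair.IsReal.covolume_eq` — hence `covol(Λ) = Ω₀Ω₀'` (rectangular), `Ω₀Ω₀'/2` (rhombic)
  for the Lebesgue area of a fundamental parallelogram (Mathlib `ZLattice.covolume`);
* `PeriodPair.IsReal.half_sum_notMem_of_discr_pos`, `PeriodPair.IsReal.discr_pos_of_half_sum_notMem`
  — for the cubic `f = 4x³ − g₂x − g₃` of `Λ` (`g₂, g₃` real): `disc f = g₂³ − 27g₃² > 0` iff the
  lattice is rectangular (given `disc f ≠ 0`), i.e. iff `f` has three real roots (Lawden §6.16;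
  Silverman, *ATAEC*, V.2.3.1: "`Δ > 0` iff `E(ℝ)` has two components");
* `PeriodPair.IsReal.two_mul_covolume_eq` — the form consumed downstream:
  **`2 covol(Λ) = n · Ω₀ · Ω₀'`** with `n = 2` if `disc f > 0` and `n = 1` otherwise, the same
  `n` as in the real-period formula `PeriodPair.IsReal.realPeriod_formula`
  (`∫_{E(ℝ)}|ω| = n Ω₀`), so that `∫_{E(ℝ)}|ω| · Ω₀' = 2 covol(Λ) = ∫_{E(ℂ)} |ω ∧ ω̄|`;
* the homothety lemmas `PeriodPair.minRealPeriod_eq_of_lattice_eq`,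
  `PeriodPair.lattice_mulLeft_mulLeft`, `PeriodPair.IsReal.mulLeft_ofReal`,
  `PeriodPair.minRealPeriod_mulLeft_ofReal` (`Ω₀(tΛ) = tΩ₀(Λ)` for real `t > 0`).

These are the lattice-theoretic inputs of the archimedean comparison
`Ω(E/ℝ) · Ω(E^{(D)}/ℝ) · √|D| = n · ∫_{E(ℂ)}|ω ∧ ω̄|` (`D < 0`) between the real periods of an
elliptic curve and its quadratic twist and the complex period, file
`BSDQuadraticDescentArchimedeanProofs` (towards `WeierstrassCurve.bsdRHS_baseChange_quadratic`).

## References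

* D. F. Lawden, *Elliptic Functions and Applications*, Applied Math. Sciences 80, Springer (1989),
  §6.15 (primitive periods `2ω₁` real, `2ω₂` or `ω₁ + ω₂'` ; rectangular and rhombic lattices),
  §6.16 (sign of the discriminant). [Lawden1989]
* J. H. Silverman, *Advanced Topics in the Arithmetic of Elliptic Curves*, GTM 151 (1994), §V.2,
  Cor. V.2.3.1; *The Arithmetic of Elliptic Curves*, 2nd ed. (2009), C.16. [SilvermanAEC2009]
* J. E. Cremona, *Algorithms for Modular Elliptic Curves*, 2nd ed., CUP (1997), §2.10, pp. 29–30
  (rectangular `[x, yi]` versus `[2x, x + yi]` period lattices; sign of the discriminant;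
  `Ω = 2Ω₀` resp. `Ω₀`). [CremonaAlgorithms1997]

## Design notes

Theorems only; deliberate dot-notation extensions of Mathlib's `PeriodPair` namespace, as in the
sibling files `RealLatticePeriod*`. The "rhombic" condition is written out as the membership
`((Ω₀ : ℂ) + I Ω₀') / 2 ∈ Λ` rather than given a name. The covolume of a period lattice in terms
of its periods, `covol = |re ω₁ im ω₂ − re ω₂ im ω₁|`, is re-derived here as a private lemma
(it is `PeriodPair.covolume_lattice_eq` of `ComplexMultiplicationBurungaleFlachCorOneProofs`,
not imported to keep this analytic file below the complex-multiplication files in the import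
graph). For the same reason the elementary lemmas `exists_two_mul_re_eq`,
`exists_two_mul_im_eq`, `half_sum_notMem_of_discr_pos` parallel
`PeriodPair.IsReal.exists_re_eq_int_mul_half`, `….exists_im_eq_int_mul_half`,
`….half_add_I_mul_half_notMem_of_discr_pos` of `ModularCurveRealPeriodProofs` (which imports the
modular-curve and `p`-adic `L`-function files), and `iΩ₀' ∈ Λ` (`….I_mul_minRealPeriod_mem`
there) is re-derived inline where needed; the new content here is the explicit basis, the
covolume, and the converse direction `discr_pos_of_half_sum_notMem`.
-/

noncomputable section

open scoped ComplexConjugate Pointwise Classical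
open Complex Set MeasureTheory

namespace PeriodPair

variable {L : PeriodPair}

/-! ### Lattice invariants only depend on the lattice; homotheties -/

/-- The least positive real period only depends on the lattice, not on the chosen basis.
[folklore] -/
theorem minRealPeriod_eq_of_lattice_eq {L L' : PeriodPair} (h : L.lattice = L'.lattice) :
    L.minRealPeriod = L'.minRealPeriod := by
  rw [L.minRealPeriod_def, L'.minRealPeriod_def, h]

/-- Iterated homotheties: `b(aΛ) = (ba)Λ` as lattices. [folklore] -/
theorem lattice_mulLeft_mulLeft (L : PeriodPair) {a b : ℂ} (ha : a ≠ 0) (hb : b ≠ 0) :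
    ((L.mulLeft a ha).mulLeft b hb).lattice = (L.mulLeft (b * a) (mul_ne_zero hb ha)).lattice := by
  ext x
  simp only [mem_mulLeft_lattice]
  rw [show a⁻¹ * (b⁻¹ * x) = (b * a)⁻¹ * x by ring]

/-- A real homothety of a real lattice is a real lattice. [folklore] -/
theorem IsReal.mulLeft_ofReal (h : L.IsReal) {t : ℝ} (ht : (t : ℂ) ≠ 0) :
    (L.mulLeft t ht).IsReal := by
  intro z hz
  rw [mem_mulLeft_lattice] at hz ⊢
  have h1 : (t : ℂ)⁻¹ * conj z = conj ((t : ℂ)⁻¹ * z) := by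
    rw [map_mul, map_inv₀, Complex.conj_ofReal]
  rw [h1]
  exact h _ hz

/-- The positive real periods of `tΛ` (`t > 0` real) are `t` times those of `Λ`. [folklore] -/
theorem realPeriods_mulLeft_ofReal (L : PeriodPair) {t : ℝ} (ht : 0 < t) :
    (L.mulLeft t (by exact_mod_cast ht.ne')).realPeriods = t • L.realPeriods := by
  ext s
  rw [mem_realPeriods, Set.mem_smul_set]
  constructor
  · rintro ⟨hs, hmem⟩
    refine ⟨t⁻¹ * s, ⟨by positivity, ?_⟩, by rw [smul_eq_mul, mul_inv_cancel_left₀ ht.ne']⟩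
    rw [mem_mulLeft_lattice] at hmem
    exact_mod_cast hmem
  · rintro ⟨r, ⟨hr, hmem⟩, rfl⟩
    refine ⟨by rw [smul_eq_mul]; positivity, ?_⟩
    rw [mem_mulLeft_lattice, smul_eq_mul]
    push_cast
    rwa [inv_mul_cancel_left₀ (by exact_mod_cast ht.ne' : (t : ℂ) ≠ 0)]

/-- `Ω₀(tΛ) = t Ω₀(Λ)` for real `t > 0`. [folklore] -/
theorem minRealPeriod_mulLeft_ofReal (L : PeriodPair) {t : ℝ} (ht : 0 < t) :
    (L.mulLeft t (by exact_mod_cast ht.ne')).minRealPeriod = t * L.minRealPeriod := by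
  rw [minRealPeriod, realPeriods_mulLeft_ofReal L ht, Real.sInf_smul_of_nonneg ht.le, smul_eq_mul,
    minRealPeriod]

/-! ### Real and imaginary parts of the points of a real lattice -/

/-- For a real lattice, `2 re z ∈ ℤΩ₀` for every `z ∈ Λ` (`z + z̄ ∈ Λ ∩ ℝ = ℤΩ₀`, Lawden §6.15).
[folklore] -/
theorem IsReal.exists_two_mul_re_eq (h : L.IsReal) {z : ℂ} (hz : z ∈ L.lattice) :
    ∃ k : ℤ, 2 * z.re = k * L.minRealPeriod := by
  refine h.exists_eq_int_mul ?_
  rw [← Complex.add_conj]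
  exact add_mem hz (h z hz)

/-- For a real lattice, `2 im z ∈ ℤΩ₀'` for every `z ∈ Λ`, where `Ω₀'` is the least positive real
period of `iΛ` (`i(z̄ − z) = 2 im z ∈ iΛ ∩ ℝ`, Lawden §6.15). [folklore] -/
theorem IsReal.exists_two_mul_im_eq (h : L.IsReal) {z : ℂ} (hz : z ∈ L.lattice) :
    ∃ k : ℤ, 2 * z.im = k * (L.mulLeft I I_ne_zero).minRealPeriod := by
  refine h.mulLeft_I.exists_eq_int_mul ?_
  have h1 : z - conj z = ((2 * z.im : ℝ) : ℂ) * I := Complex.sub_conj z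
  have h2 : ((2 * z.im : ℝ) : ℂ) = I * (conj z - z) := by
    linear_combination I * h1 + ((2 * z.im : ℝ) : ℂ) * Complex.I_sq
  rw [h2]
  exact mul_mem_mulLeft_lattice.mpr (sub_mem (h z hz) hz)

/-- `iΩ₀'/2 ∉ Λ` (else `Ω₀'/2` would be a real period of `iΛ` below the least one). [folklore] -/
theorem IsReal.I_mul_minRealPeriod_div_two_notMem (h : L.IsReal) :
    I * ((L.mulLeft I I_ne_zero).minRealPeriod : ℂ) / 2 ∉ L.lattice := by
  intro hmem
  have h' := h.mulLeft_I
  set Ω' := (L.mulLeft I I_ne_zero).minRealPeriod with hΩ'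
  have h1 : I * (I * (Ω' : ℂ) / 2) ∈ (L.mulLeft I I_ne_zero).lattice :=
    mul_mem_mulLeft_lattice.mpr hmem
  have h2 : I * (I * (Ω' : ℂ) / 2) = -((Ω' / 2 : ℝ) : ℂ) := by
    push_cast
    linear_combination ((Ω' : ℂ) / 2) * Complex.I_sq
  rw [h2] at h1
  have h3 : ((Ω' / 2 : ℝ) : ℂ) ∈ (L.mulLeft I I_ne_zero).lattice := by simpa using neg_mem h1
  exact h'.ofReal_notMem_lattice (by linarith [h'.minRealPeriod_pos])
    (by linarith [h'.minRealPeriod_pos]) h3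

/-- `Ω₀/2 ∉ Λ`. [folklore] -/
theorem IsReal.minRealPeriod_div_two_notMem (h : L.IsReal) :
    (L.minRealPeriod : ℂ) / 2 ∉ L.lattice := by
  have := h.ofReal_notMem_lattice (t := L.minRealPeriod / 2) (by linarith [h.minRealPeriod_pos])
    (by linarith [h.minRealPeriod_pos])
  push_cast at this
  exact this

/-- Integer multiples of lattice points are lattice points (`ℤ`-module structure, written
multiplicatively). [folklore] -/
theorem intCast_mul_mem {x : ℂ} (hx : x ∈ L.lattice) (j : ℤ) : (j : ℂ) * x ∈ L.lattice := by
  simpa [zsmul_eq_mul] using zsmul_mem hx j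

/-- **Parity constraint** (Lawden §6.15): if `z ∈ Λ` has `2z = kΩ₀ + k'·iΩ₀'` then
`k ≡ k' (mod 2)` — otherwise `Ω₀/2` or `iΩ₀'/2` would be a lattice point. [folklore] -/
theorem IsReal.even_iff_even (h : L.IsReal) {z : ℂ} (hz : z ∈ L.lattice) {k k' : ℤ}
    (hk : 2 * z = k * (L.minRealPeriod : ℂ) +
      k' * (I * ((L.mulLeft I I_ne_zero).minRealPeriod : ℂ))) :
    Even k ↔ Even k' := by
  set Ω := L.minRealPeriod with hΩ
  set Ω' := (L.mulLeft I I_ne_zero).minRealPeriod with hΩ'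
  have hΩmem : (Ω : ℂ) ∈ L.lattice := h.minRealPeriod_mem_lattice
  have hΩ'mem : I * (Ω' : ℂ) ∈ L.lattice := by
    -- `iΩ₀' ∈ Λ` (`PeriodPair.IsReal.I_mul_minRealPeriod_mem` of `ModularCurveRealPeriodProofs`)
    have h1 := h.mulLeft_I.minRealPeriod_mem_lattice
    rw [mem_mulLeft_lattice, Complex.inv_I, neg_mul] at h1
    simpa using neg_mem h1
  constructor
  · rintro ⟨j, rfl⟩
    by_contra hodd
    rw [Int.not_even_iff_odd] at hodd
    obtain ⟨j', rfl⟩ := hodd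
    push_cast at hk
    apply h.I_mul_minRealPeriod_div_two_notMem
    have : I * (Ω' : ℂ) / 2 = z - j * (Ω : ℂ) - j' * (I * (Ω' : ℂ)) := by
      linear_combination (-1 / 2 : ℂ) * hk
    rw [this]
    exact sub_mem (sub_mem hz (intCast_mul_mem hΩmem j)) (intCast_mul_mem hΩ'mem j')
  · rintro ⟨j', rfl⟩
    by_contra hodd
    rw [Int.not_even_iff_odd] at hodd
    obtain ⟨j, rfl⟩ := hodd
    push_cast at hk
    apply h.minRealPeriod_div_two_notMem
    have : (Ω : ℂ) / 2 = z - j * (Ω : ℂ) - j' * (I * (Ω' : ℂ)) := by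
      linear_combination (-1 / 2 : ℂ) * hk
    rw [this]
    exact sub_mem (sub_mem hz (intCast_mul_mem hΩmem j)) (intCast_mul_mem hΩ'mem j')

/-! ### Classification: a real lattice is rectangular or rhombic, with an explicit basis -/

/-- A non-zero real number and a complex number with non-zero imaginary part are `ℝ`-linearly
independent. [folklore] -/
theorem linearIndependent_ofReal_of_im_ne_zero {a : ℝ} {w : ℂ} (ha : a ≠ 0) (hw : w.im ≠ 0) :
    LinearIndependent ℝ ![(a : ℂ), w] := by
  refine LinearIndependent.pair_iff.mpr fun s t hst => ?_
  have him := congrArg Complex.im hst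
  have hre := congrArg Complex.re hst
  simp only [Complex.add_im, Complex.smul_im, Complex.ofReal_im, smul_eq_mul, mul_zero, zero_add,
    Complex.zero_im, mul_eq_zero] at him
  have ht : t = 0 := him.resolve_right hw
  subst ht
  simp only [Complex.add_re, Complex.smul_re, Complex.ofReal_re, smul_eq_mul, zero_mul, add_zero,
    Complex.zero_re, mul_eq_zero] at hre
  exact ⟨hre.resolve_right ha, rfl⟩

/-- **Real lattices are rectangular or rhombic, with an explicit basis** (Lawden §6.15: the
primitive periods of a real lattice may be taken to be `2ω₁` real and either `2ω₂` purely
imaginary or `2ω₂ = ω₁' + ω₂'` with `2ω₂ − 2ω₁` purely imaginary): for a real lattice `Λ` with least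
positive real period `Ω₀` and least positive real period `Ω₀'` of `iΛ`, the period pair
`(Ω₀, ω)` spans `Λ`, where `ω = (Ω₀ + iΩ₀')/2` if this point lies in `Λ` (*rhombic* lattice) and
`ω = iΩ₀'` otherwise (*rectangular* lattice). Proof: for `z ∈ Λ`, `2z = kΩ₀ + k'iΩ₀'` with
`k ≡ k' (mod 2)` (`exists_two_mul_re_eq`, `exists_two_mul_im_eq`, `even_iff_even`). Cremona,
*Algorithms for Modular Elliptic Curves*, §2.10 (pp. 29–30): with `x = Ω₀`, `y = Ω₀'` the period
lattice is either `[x, yi]` ("rectangular") or `[2x', x' + yi]`-shaped, "the lattice spanned by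
`Ω₀(f)` and `Ω_im(f)` may have index `2` in `Λ_f`". [cite: CremonaAlgorithms1997, §2.10 (pp. 29–30)] -/
theorem IsReal.exists_eq_lattice (h : L.IsReal) :
    ∃ L₀ : PeriodPair, L₀.lattice = L.lattice ∧ L₀.ω₁ = L.minRealPeriod ∧
      L₀.ω₂ = if ((L.minRealPeriod : ℂ) + I * (L.mulLeft I I_ne_zero).minRealPeriod) / 2 ∈ L.lattice
        then ((L.minRealPeriod : ℂ) + I * (L.mulLeft I I_ne_zero).minRealPeriod) / 2
        else I * (L.mulLeft I I_ne_zero).minRealPeriod := by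
  set Ω := L.minRealPeriod with hΩdef
  set Ω' := (L.mulLeft I I_ne_zero).minRealPeriod with hΩ'def
  have hΩ : 0 < Ω := h.minRealPeriod_pos
  have hΩ' : 0 < Ω' := h.mulLeft_I.minRealPeriod_pos
  have hΩmem : (Ω : ℂ) ∈ L.lattice := h.minRealPeriod_mem_lattice
  have hΩ'mem : I * (Ω' : ℂ) ∈ L.lattice := by
    -- `iΩ₀' ∈ Λ` (`PeriodPair.IsReal.I_mul_minRealPeriod_mem` of `ModularCurveRealPeriodProofs`)
    have h1 := h.mulLeft_I.minRealPeriod_mem_lattice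
    rw [mem_mulLeft_lattice, Complex.inv_I, neg_mul] at h1
    simpa using neg_mem h1
  set ω : ℂ := if ((Ω : ℂ) + I * Ω') / 2 ∈ L.lattice then ((Ω : ℂ) + I * Ω') / 2 else I * Ω'
    with hωdef
  have hωim : ω.im ≠ 0 := by
    rw [hωdef]
    split_ifs
    · simp; positivity
    · simp; positivity
  have hωmem : ω ∈ L.lattice := by
    rw [hωdef]
    split_ifs with hr
    · exact hr
    · exact hΩ'mem
  refine ⟨⟨Ω, ω, linearIndependent_ofReal_of_im_ne_zero hΩ.ne' hωim⟩, ?_, rfl, rfl⟩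
  apply le_antisymm
  · refine Submodule.span_le.mpr ?_
    rintro x (rfl | rfl)
    · exact hΩmem
    · exact hωmem
  · intro z hz
    obtain ⟨k, hk⟩ := h.exists_two_mul_re_eq hz
    obtain ⟨k', hk'⟩ := h.exists_two_mul_im_eq hz
    have h2z : 2 * z = k * (Ω : ℂ) + k' * (I * (Ω' : ℂ)) := by
      have e1 : ((2 * z.re : ℝ) : ℂ) = k * (Ω : ℂ) := by rw [hk]; push_cast; ring
      have e2 : ((2 * z.im : ℝ) : ℂ) = k' * (Ω' : ℂ) := by rw [hk']; push_cast; ring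
      calc 2 * z = 2 * ((z.re : ℂ) + z.im * I) := by rw [Complex.re_add_im]
        _ = ((2 * z.re : ℝ) : ℂ) + ((2 * z.im : ℝ) : ℂ) * I := by push_cast; ring
        _ = k * (Ω : ℂ) + k' * (I * (Ω' : ℂ)) := by rw [e1, e2]; ring
    have hpar : Even k ↔ Even k' := h.even_iff_even hz h2z
    rw [mem_lattice]
    by_cases hr : ((Ω : ℂ) + I * Ω') / 2 ∈ L.lattice
    · -- rhombic: `z = ((k - k')/2) Ω₀ + k' ω`
      have hω : ω = ((Ω : ℂ) + I * Ω') / 2 := by rw [hωdef, if_pos hr]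
      obtain ⟨j, hj⟩ : Even (k - k') := Int.even_sub.mpr hpar
      have hjC : (k : ℂ) - k' = j + j := by exact_mod_cast hj
      refine ⟨j, k', ?_⟩
      change (j : ℂ) * (Ω : ℂ) + k' * ω = z
      rw [hω]
      linear_combination (-1 / 2 : ℂ) * h2z + (-(Ω : ℂ) / 2) * hjC
    · -- rectangular: `k, k'` are both even and `z = (k/2) Ω₀ + (k'/2) iΩ₀'`
      have hω : ω = I * Ω' := by rw [hωdef, if_neg hr]
      have hk'even : Even k' := by
        by_contra hodd
        obtain ⟨j', rfl⟩ := Int.not_even_iff_odd.mp hodd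
        have hkodd : Odd k := Int.not_even_iff_odd.mp fun hke => hodd (hpar.mp hke)
        obtain ⟨j, rfl⟩ := hkodd
        apply hr
        push_cast at h2z
        have : ((Ω : ℂ) + I * Ω') / 2 = z - j * (Ω : ℂ) - j' * (I * (Ω' : ℂ)) := by
          linear_combination (-1 / 2 : ℂ) * h2z
        rw [this]
        exact sub_mem (sub_mem hz (intCast_mul_mem hΩmem j)) (intCast_mul_mem hΩ'mem j')
      obtain ⟨j', rfl⟩ := hk'even
      obtain ⟨j, rfl⟩ := hpar.mpr ⟨j', rfl⟩
      refine ⟨j, j', ?_⟩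
      change (j : ℂ) * (Ω : ℂ) + j' * ω = z
      rw [hω]
      push_cast at h2z
      linear_combination (-1 / 2 : ℂ) * h2z

/-! ### The covolume -/

/-- The unit square has Lebesgue measure one (the fundamental domain of the `ℝ`-basis `(1, i)`
of `ℂ`). (Private copy of `Literature.NumberTheory.EllipticCurves.volume_real_fundamentalDomain_basisOneI`,
see the design notes.) [folklore] -/
private theorem volume_real_fundamentalDomain_basisOneI_aux :
    (volume : Measure ℂ).real (ZSpan.fundamentalDomain Complex.basisOneI) = 1 := by
  rw [measureReal_congr (ZSpan.fundamentalDomain_ae_parallelepiped Complex.basisOneI volume),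
    measureReal_def, Complex.coe_basisOneI, ← Complex.coe_orthonormalBasisOneI,
    Complex.orthonormalBasisOneI.volume_parallelepiped, ENNReal.toReal_one]

/-- Covolume of a period lattice in terms of its periods: `covol(ℤω₁ + ℤω₂) = |Im(ω̄₁ω₂)|`.
(Private copy of `PeriodPair.covolume_lattice_eq`, see the design notes.) [folklore] -/
private theorem covolume_lattice_eq_aux (L : PeriodPair) :
    ZLattice.covolume L.lattice = |L.ω₁.re * L.ω₂.im - L.ω₂.re * L.ω₁.im| := by
  rw [ZLattice.covolume_eq_det_mul_measureReal L.lattice volume L.latticeBasis Complex.basisOneI,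
    volume_real_fundamentalDomain_basisOneI_aux, mul_one]
  have h1 : ((↑) : L.lattice → ℂ) ∘ L.latticeBasis = L.basis := by
    ext i
    fin_cases i <;> simp
  rw [h1, Module.Basis.det_apply, Matrix.det_fin_two]
  simp [Module.Basis.toMatrix_apply, Complex.coe_basisOneI_repr]

/-- **Covolume of a real lattice** (Lawden §6.15–§6.16; the Lebesgue area of the period
parallelogram): `covol(Λ) = Ω₀Ω₀'/2` if `(Ω₀ + iΩ₀')/2 ∈ Λ` (rhombic lattice, basis
`Ω₀, (Ω₀ + iΩ₀')/2`) and `covol(Λ) = Ω₀Ω₀'` otherwise (rectangular lattice, basis `Ω₀, iΩ₀'`).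
[folklore] -/
theorem IsReal.covolume_eq (h : L.IsReal) :
    ZLattice.covolume L.lattice =
      if ((L.minRealPeriod : ℂ) + I * (L.mulLeft I I_ne_zero).minRealPeriod) / 2 ∈ L.lattice then
        L.minRealPeriod * (L.mulLeft I I_ne_zero).minRealPeriod / 2
      else L.minRealPeriod * (L.mulLeft I I_ne_zero).minRealPeriod := by
  obtain ⟨L₀, hL₀, hω₁, hω₂⟩ := h.exists_eq_lattice
  have hΩ : 0 < L.minRealPeriod := h.minRealPeriod_pos
  have hΩ' : 0 < (L.mulLeft I I_ne_zero).minRealPeriod := h.mulLeft_I.minRealPeriod_pos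
  have hcov : ZLattice.covolume L.lattice = ZLattice.covolume L₀.lattice := by simp only [hL₀]
  rw [hcov, covolume_lattice_eq_aux, hω₁, hω₂]
  split_ifs with hr
  · simp only [Complex.ofReal_re, Complex.ofReal_im, Complex.div_ofNat_re, Complex.div_ofNat_im,
      Complex.add_re, Complex.add_im, Complex.mul_re, Complex.mul_im, Complex.I_re, Complex.I_im,
      zero_mul, one_mul, mul_zero, sub_zero, zero_add, add_zero]
    rw [abs_of_pos (by positivity)]
    ring
  · simp only [Complex.ofReal_re, Complex.ofReal_im, Complex.mul_re, Complex.mul_im, Complex.I_re,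
      Complex.I_im, zero_mul, one_mul, mul_zero, sub_zero, zero_add]
    rw [abs_of_pos (by positivity)]

/-! ### The sign of the discriminant: rectangular iff `g₂³ − 27g₃² > 0` -/

/-- **`disc f > 0` ⇒ rectangular** (Lawden §6.16): if `g₂³ − 27g₃² > 0` then
`(Ω₀ + iΩ₀')/2 ∉ Λ`. Otherwise `℘(iΩ₀'/2) = ℘(−Ω₀/2) = e₁` would be the only real root of
`f = 4x³ − g₂x − g₃` (`f > 0` on `(e₁, ∞)`, `f < 0` on `(−∞, ℘(iΩ₀'/2))`, `cubic_pos_of_lt`,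
`cubic_neg_of_lt`), whereas for `disc f = (g₂ − 3e₁²)(12e₁² − g₂)² > 0` the quadratic cofactor of
`x − e₁` has the two real roots `(−e₁ ± √(g₂ − 3e₁²))/2`. (This is the argument of the rhombic
case of `IsReal.integral_inv_sqrt_cubic_of_discr_pos_eq`, isolated; Cremona §2.10, p. 30: "In this
case the period lattice is rectangular … and the elliptic curve has positive discriminant.")
[cite: Lawden1989, §6.16] [cite: CremonaAlgorithms1997, §2.10 (p. 30)] -/
theorem IsReal.half_sum_notMem_of_discr_pos (h : L.IsReal)
    (hdisc : 0 < L.g₂.re ^ 3 - 27 * L.g₃.re ^ 2) :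
    ((L.minRealPeriod : ℂ) + I * (L.mulLeft I I_ne_zero).minRealPeriod) / 2 ∉ L.lattice := by
  intro hcase
  set e₁ := L.weierstrassPRe (L.minRealPeriod / 2) with he₁_def
  set A := L.g₂.re with hA
  set B := L.g₃.re with hB
  have he₁ : 4 * e₁ ^ 3 - A * e₁ - B = 0 := h.cubic_weierstrassPRe_half
  have hright : ∀ x, e₁ < x → 0 < 4 * x ^ 3 - A * x - B := fun x hx ↦ h.cubic_pos_of_lt hx
  set L' := L.mulLeft I I_ne_zero with hL'
  set w : ℂ := I * ((L'.minRealPeriod / 2 : ℝ) : ℂ) with hw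
  have hPw : (℘[L] w).re = -L'.weierstrassPRe (L'.minRealPeriod / 2) := by
    rw [hw, weierstrassP_I_mul, Complex.neg_re]
    rfl
  have hleft : ∀ x, x < (℘[L] w).re → 4 * x ^ 3 - A * x - B < 0 := by
    intro x hx
    rw [hPw] at hx
    exact h.cubic_neg_of_lt hx
  have hcase' : w + ((L.minRealPeriod / 2 : ℝ) : ℂ) ∈ L.lattice := by
    convert hcase using 1
    rw [hw]; push_cast; ring
  -- `℘(w) = ℘(-Ω₀/2) = e₁` is the only real root of `f`
  have hPw' : (℘[L] w).re = e₁ := by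
    have := L.weierstrassP_sub_coe w ⟨_, hcase'⟩
    rw [Subtype.coe_mk, show w - (w + ((L.minRealPeriod / 2 : ℝ) : ℂ)) =
      -((L.minRealPeriod / 2 : ℝ) : ℂ) by ring, weierstrassP_neg] at this
    rw [← this]
    rfl
  have honly : ∀ r, 4 * r ^ 3 - A * r - B = 0 → r = e₁ := by
    intro r hr
    rcases lt_trichotomy r e₁ with hlt | heq | hgt
    · have := hleft r (by rw [hPw']; exact hlt)
      rw [hr] at this
      exact absurd this (lt_irrefl 0)
    · exact heq
    · have := hright r hgt
      rw [hr] at this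
      exact absurd this (lt_irrefl 0)
  have hD : 0 < A - 3 * e₁ ^ 2 := by
    rw [cubic_discr_eq_of_root he₁] at hdisc
    exact pos_of_mul_pos_left hdisc (sq_nonneg _)
  set s := Real.sqrt (A - 3 * e₁ ^ 2) with hs
  have hs2 : s ^ 2 = A - 3 * e₁ ^ 2 := Real.sq_sqrt hD.le
  have hs0 : 0 < s := Real.sqrt_pos.mpr hD
  have hr₁ : 4 * ((-e₁ + s) / 2) ^ 3 - A * ((-e₁ + s) / 2) - B = 0 := by
    rw [cubic_eq_mul_of_root he₁]
    have : 4 * ((-e₁ + s) / 2) ^ 2 + 4 * e₁ * ((-e₁ + s) / 2) + (4 * e₁ ^ 2 - A) = 0 := by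
      linear_combination hs2
    rw [this, mul_zero]
  have hr₂ : 4 * ((-e₁ - s) / 2) ^ 3 - A * ((-e₁ - s) / 2) - B = 0 := by
    rw [cubic_eq_mul_of_root he₁]
    have : 4 * ((-e₁ - s) / 2) ^ 2 + 4 * e₁ * ((-e₁ - s) / 2) + (4 * e₁ ^ 2 - A) = 0 := by
      linear_combination hs2
    rw [this, mul_zero]
  have h1 := honly _ hr₁
  have h2 := honly _ hr₂
  linarith

/-- **Rectangular ⇒ `disc f > 0`** (Lawden §6.16, §6.12): if `(Ω₀ + iΩ₀')/2 ∉ Λ` (and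
`g₂³ − 27g₃² ≠ 0`) then `g₂³ − 27g₃² > 0`. For then the horizontal half-period line
`iΩ₀'/2 + ℝ` misses `Λ`, `℘` maps it onto a bounded interval `[m, M]` between two real roots of
`f` (`IsReal.exists_Ioo_integral_eq_of_line`), and together with `e₁ = ℘(Ω₀/2) > M` the cubic has
three distinct real roots, `f = 4(x − m)(x − M)(x − e₁)`, so that
`disc f = 16 (m − M)² (m − e₁)² (M − e₁)² > 0` (Cremona §2.10, p. 30: in the non-rectangular case
"the elliptic curve has negative discriminant").
[cite: Lawden1989, §6.16] [cite: CremonaAlgorithms1997, §2.10 (p. 30)] -/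
theorem IsReal.discr_pos_of_half_sum_notMem (h : L.IsReal)
    (hdisc : L.g₂.re ^ 3 - 27 * L.g₃.re ^ 2 ≠ 0)
    (hcase : ((L.minRealPeriod : ℂ) + I * (L.mulLeft I I_ne_zero).minRealPeriod) / 2 ∉ L.lattice) :
    0 < L.g₂.re ^ 3 - 27 * L.g₃.re ^ 2 := by
  set e₁ := L.weierstrassPRe (L.minRealPeriod / 2) with he₁_def
  set A := L.g₂.re with hA
  set B := L.g₃.re with hB
  have hΩ := h.minRealPeriod_pos
  have he₁ : 4 * e₁ ^ 3 - A * e₁ - B = 0 := h.cubic_weierstrassPRe_half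
  have hright : ∀ x, e₁ < x → 0 < 4 * x ^ 3 - A * x - B := fun x hx ↦ h.cubic_pos_of_lt hx
  have h12 : 12 * e₁ ^ 2 - A ≠ 0 := by
    intro h0
    rw [cubic_discr_eq_of_root he₁, h0] at hdisc
    simp at hdisc
  set w : ℂ := I * (((L.mulLeft I I_ne_zero).minRealPeriod / 2 : ℝ) : ℂ) with hw
  have h2w : 2 * w ∈ L.lattice := by
    have h1 := h.mulLeft_I.minRealPeriod_mem_lattice
    rw [mem_mulLeft_lattice, Complex.inv_I, neg_mul] at h1
    convert neg_mem h1 using 1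
    rw [hw]; push_cast; ring
  have hcw : conj w = -w := by
    rw [hw, map_mul, Complex.conj_I, Complex.conj_ofReal]; ring
  have hw_notMem : w ∉ L.lattice := by
    convert h.I_mul_minRealPeriod_div_two_notMem using 1
    rw [hw]; push_cast; ring
  have hcase' : w + ((L.minRealPeriod / 2 : ℝ) : ℂ) ∉ L.lattice := by
    convert hcase using 1
    rw [hw]; push_cast; ring
  -- the line `w + ℝ` misses `Λ`
  have hline : ∀ t : ℝ, w + t ∉ L.lattice := by
    intro t ht
    have hct : -w + t ∈ L.lattice := by
      have := h _ ht
      rwa [map_add, hcw, Complex.conj_ofReal] at this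
    have h2t : ((2 * t : ℝ) : ℂ) ∈ L.lattice := by
      convert add_mem ht hct using 1
      push_cast; ring
    obtain ⟨k, hk⟩ := h.exists_eq_int_mul h2t
    have hΩmem : (L.minRealPeriod : ℂ) ∈ L.lattice := h.minRealPeriod_mem_lattice
    rcases Int.even_or_odd k with ⟨j, rfl⟩ | ⟨j, rfl⟩
    · have ht' : t = j * L.minRealPeriod := by push_cast at hk; linarith
      have htmem : (t : ℂ) ∈ L.lattice := by
        rw [ht']; push_cast
        exact intCast_mul_mem hΩmem j
      exact hw_notMem (by simpa using sub_mem ht htmem)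
    · have ht' : t = j * L.minRealPeriod + L.minRealPeriod / 2 := by push_cast at hk; linarith
      refine hcase' ?_
      convert sub_mem ht (intCast_mul_mem hΩmem j) using 1
      rw [ht']; push_cast; ring
  obtain ⟨m, M, hmM, hfm, hfM, hfpos, -⟩ := h.exists_Ioo_integral_eq_of_line h2w hcw hline
  have hMe : M ≤ e₁ := by
    by_contra hcon
    push Not at hcon
    have := hright M hcon
    rw [hfM] at this
    exact lt_irrefl 0 this
  have hMne : M ≠ e₁ := by
    intro hMe₁
    apply h12
    exact twelve_mul_sq_sub_eq_zero he₁ (m := m) (by rw [← hMe₁]; exact hmM)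
      (fun x hx ↦ hfpos x (by rw [hMe₁]; exact hx)) hright
  have hMlt : M < e₁ := lt_of_le_of_ne hMe hMne
  have hme : m ≠ e₁ := (hmM.trans hMlt).ne
  have hprod := cubic_eq_prod_of_roots hmM.ne hme hMne hfm hfM he₁
  -- read off `A`, `B` from the factorisation and compute the discriminant
  have h0 := hprod 0
  have h1 := hprod 1
  have hn1 := hprod (-1)
  have hsum : m + M + e₁ = 0 := by nlinarith [h0, h1, hn1]
  have hA' : A = -4 * (m * M + M * e₁ + e₁ * m) := by nlinarith [h0, h1, hn1, hsum]
  have hB' : B = 4 * (m * M * e₁) := by nlinarith [h0, h1, hn1, hsum]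
  have hdisc' : A ^ 3 - 27 * B ^ 2 = 16 * ((m - M) * (m - e₁) * (M - e₁)) ^ 2 := by
    have he : e₁ = -m - M := by linarith
    rw [hA', hB', he]; ring
  rw [hdisc']
  have hne : (m - M) * (m - e₁) * (M - e₁) ≠ 0 :=
    mul_ne_zero (mul_ne_zero (sub_ne_zero.mpr hmM.ne) (sub_ne_zero.mpr hme))
      (sub_ne_zero.mpr hMne)
  positivity

/-- **`2 covol(Λ) = n · Ω₀ · Ω₀'`** with `n = 2` if `g₂³ − 27g₃² > 0` (rectangular lattice) and
`n = 1` otherwise (rhombic lattice), for a real lattice with `g₂³ − 27g₃² ≠ 0` — the same `n` as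
in the real-period formula `IsReal.realPeriod_formula` (`2∫_{f>0} dx/√f = n Ω₀`), so that for the
period lattice of an elliptic curve over `ℝ`:
`∫_{E(ℝ)}|ω| · Ω₀' = n Ω₀ Ω₀' = 2 covol(Λ) = ∫_{E(ℂ)}|ω ∧ ω̄|`. (Lawden §6.15–§6.16; Cremona,
*Algorithms for Modular Elliptic Curves*, §2.10, pp. 29–30: `Ω(f) = 2Ω₀(f)` for a rectangular
lattice `[x, yi]`, `Ω(f) = Ω₀(f)` for `[2x, x + yi]`.) [cite: CremonaAlgorithms1997, §2.10 (pp. 29–30)] -/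
theorem IsReal.two_mul_covolume_eq (h : L.IsReal) (hdisc : L.g₂.re ^ 3 - 27 * L.g₃.re ^ 2 ≠ 0) :
    2 * ZLattice.covolume L.lattice =
      (if 0 < L.g₂.re ^ 3 - 27 * L.g₃.re ^ 2 then 2 else 1 : ℝ) * L.minRealPeriod *
        (L.mulLeft I I_ne_zero).minRealPeriod := by
  rw [h.covolume_eq]
  by_cases hcase : ((L.minRealPeriod : ℂ) + I * (L.mulLeft I I_ne_zero).minRealPeriod) / 2 ∈
      L.lattice
  · have hnot : ¬ 0 < L.g₂.re ^ 3 - 27 * L.g₃.re ^ 2 := fun hpos =>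
      h.half_sum_notMem_of_discr_pos hpos hcase
    rw [if_pos hcase, if_neg hnot]
    ring
  · rw [if_neg hcase, if_pos (h.discr_pos_of_half_sum_notMem hdisc hcase)]
    ring

end PeriodPair

end
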